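import Summits.NavierStokesRegularity.NavierStokesRegularity.Theses.HubbleDynamo
import Summits.NavierStokesRegularity.NavierStokesRegularity.Theorems.HubbleDynamoNoSelfExcitedDynamoStubSingleTimeSwitchOff
import Summits.NavierStokesRegularity.NavierStokesRegularity.Theorems.HubbleDynamoNoSelfExcitedDynamoRemotePast
import Summits.NavierStokesRegularity.NavierStokesRegularity.Theorems.HubbleDynamoNoSelfExcitedDynamoEquivalence
import HarnessLib

/-!
# Crux `NoSelfExcitedDynamo` (stmt-NavierStokesRegularity-1934), line `registered` v6: what the open
  stub (G) `stub_noTypeIProfile` says — every eternal profile flow SWITCHES OFF — and the converse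
  direction crux ⇒ (G)

Theorems file (lands `--supports stmt-NavierStokesRegularity-1934`; registered sub-goals
`noTypeIProfile_iff_switchOff`, `noTypeIProfile_of_noSelfExcitedDynamo`).

(G) is the statement: every eternal classical solution `(W, Q)` of Leray's backward system
`∂ₛW + ½W + ½(y·∇)W + (W·∇)W + ∇Q = ΔW`, `div W = 0` on `ℝ × ℝ³` in the uniform profile class
`(1 + ‖y‖)^{k+1}‖DᵏW(s, y)‖ ≤ K_k` becomes uniformly `δ`-small at some similarity time, for every
`δ > 0`.

* `noTypeIProfile_iff_switchOff`: (G) ⇔ every eternal profile-class solution switches off,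
  `‖W(s, y)‖ ≤ M e^{−s/2}` for `s ≥ S` — by the landed single-time switch-off theorem
  `stub_singleTimeSwitchOff` (p156442: amplitude `≤ ε ≤ ε₀` at ONE time forces `≤ 2ε e^{−(s−s₀)/2}`
  afterwards). In physical variables: the Type-I ancient field `w = ofLerayOrbit W`
  (`‖Dᵏw(t, x)‖ ≤ K_k/(‖x‖ + √(−t))^{k+1}` on `ℝ³ × (−∞, 0)`) is BOUNDED near its vertex `(0, 0)`, i.e.
  (G) is exactly POINTWISE TYPE-I BLOW-UP EXCLUSION.
* `noTypeIProfile_of_noSelfExcitedDynamo`: the crux implies (G) (the crux kills every eternal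
  profile-class solution: `stub_eternalLiouvilleOfCrux` p152276 with the switch-off clause removed by
  `eternalLiouville_of_switchOff` p155533). The forward direction (G) ⇒ crux is the composition of
  the line's skeleton v6 (file `HubbleDynamoNoSelfExcitedDynamoNoTypeIProfile.lean`).
* `not_noSelfExcitedDynamo_of_eternal_nontrivial`: for the disprover — ANY nontrivial eternal
  profile-class solution refutes the crux.
-/

noncomputable section

-- the mandated stub namespace repeats `NavierStokesRegularity` (tree precedent for this crux's stubs)
set_option linter.dupNamespace false

namespace Summit.NavierStokesRegularity.NavierStokesRegularity.Theorems.NoSelfExcitedDynamo.Registered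

open Set MeasureTheory Filter Topology
open scoped ContDiff
open Literature.Analysis.FluidPDE

/-- **(G) ⇔ every eternal profile flow switches off** (registered sub-goal
`noTypeIProfile_iff_switchOff`). (⇒) a dip below `ε₀` at time `s₀` forces
`‖W(s)‖_∞ ≤ 2ε₀ e^{−(s−s₀)/2}` for `s ≥ s₀` (`stub_singleTimeSwitchOff`); (⇐) `M e^{−s/2} < δ` for `s`
large. -/
theorem noTypeIProfile_iff_switchOff :
    (∀ (W : ℝ → EuclideanSpace ℝ (Fin 3) → EuclideanSpace ℝ (Fin 3)) (Q : ℝ → EuclideanSpace ℝ (Fin 3) → ℝ),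
      IsBackwardLeraySolutionOn univ 1 W Q →
      (∀ k : ℕ, ∃ K : ℝ, ∀ s y, (1 + ‖y‖) ^ (k + 1) * ‖iteratedFDeriv ℝ k (W s) y‖ ≤ K) →
      ∀ δ : ℝ, 0 < δ → ∃ s : ℝ, ∀ y, ‖W s y‖ < δ) ↔
    (∀ (W : ℝ → EuclideanSpace ℝ (Fin 3) → EuclideanSpace ℝ (Fin 3)) (Q : ℝ → EuclideanSpace ℝ (Fin 3) → ℝ),
      IsBackwardLeraySolutionOn univ 1 W Q →
      (∀ k : ℕ, ∃ K : ℝ, ∀ s y, (1 + ‖y‖) ^ (k + 1) * ‖iteratedFDeriv ℝ k (W s) y‖ ≤ K) →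
      ∃ M S : ℝ, ∀ s, S ≤ s → ∀ y, ‖W s y‖ ≤ M * Real.exp (-s / 2)) := by
  obtain ⟨ε₀, hε₀, hD⟩ := stub_singleTimeSwitchOff
  constructor
  · intro hG W Q hW hprof
    obtain ⟨s₀, hs₀⟩ := hG W Q hW hprof ε₀ hε₀
    refine ⟨2 * ε₀ * Real.exp (s₀ / 2), s₀, fun s hs y => ?_⟩
    have key := hD W Q hW hprof s₀ ε₀ le_rfl (fun y => (hs₀ y).le) s hs y
    calc ‖W s y‖ ≤ 2 * ε₀ * Real.exp (-(s - s₀) / 2) := key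
      _ = 2 * ε₀ * Real.exp (s₀ / 2) * Real.exp (-s / 2) := by
          rw [show -(s - s₀) / 2 = s₀ / 2 + -s / 2 by ring, Real.exp_add]; ring
  · intro hoff W Q hW hprof δ hδ
    obtain ⟨M, S, hMS⟩ := hoff W Q hW hprof
    by_cases hM : M ≤ 0
    · refine ⟨S, fun y => (hMS S le_rfl y).trans_lt ?_⟩
      exact (mul_nonpos_of_nonpos_of_nonneg hM (Real.exp_pos _).le).trans_lt hδ
    · push Not at hM
      -- choose `s ≥ S` with `M e^{-s/2} < δ`: `s = max S (2 log (M/δ) + 2)`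
      set s : ℝ := max S (2 * Real.log (M / δ) + 2) with hs
      refine ⟨s, fun y => (hMS s (le_max_left _ _) y).trans_lt ?_⟩
      have h1 : -s / 2 ≤ -(Real.log (M / δ) + 1) := by
        have : 2 * Real.log (M / δ) + 2 ≤ s := le_max_right _ _
        linarith
      have h2 : Real.exp (-s / 2) ≤ Real.exp (-(Real.log (M / δ) + 1)) := Real.exp_le_exp.2 h1
      have h3 : Real.exp (-(Real.log (M / δ) + 1)) = δ / M * Real.exp (-1) := by
        rw [neg_add, Real.exp_add, Real.exp_neg, Real.exp_log (div_pos hM hδ), inv_div]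
      have h4 : Real.exp (-1 : ℝ) < 1 := Real.exp_lt_one_iff.2 (by norm_num)
      calc M * Real.exp (-s / 2) ≤ M * (δ / M * Real.exp (-1)) := by
            rw [← h3]; exact mul_le_mul_of_nonneg_left h2 hM.le
        _ = δ * Real.exp (-1) := by field_simp
        _ < δ * 1 := mul_lt_mul_of_pos_left h4 hδ
        _ = δ := mul_one δ

/-- **The crux implies (G)** (registered sub-goal `noTypeIProfile_of_noSelfExcitedDynamo`; hypothesis
`NoSelfExcitedDynamo` written unfolded): under the crux every eternal profile-class solution vanishes
(`stub_eternalLiouvilleOfCrux`, switch-off clause removed by `eternalLiouville_of_switchOff`), so it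
is `δ`-small at every time. -/
theorem noTypeIProfile_of_noSelfExcitedDynamo :
    (∀ u : ℝ → EuclideanSpace ℝ (Fin 3) → EuclideanSpace ℝ (Fin 3),
      IsBoundedAncientMildSolution 1 u →
      (∀ t < 0, AEStronglyMeasurable (u t) volume) → (∃ C : ℝ, HasTypeIDecay C u) →
      ∀ t < 0, u t =ᵐ[volume] (0 : EuclideanSpace ℝ (Fin 3) → EuclideanSpace ℝ (Fin 3))) →
    ∀ (W : ℝ → EuclideanSpace ℝ (Fin 3) → EuclideanSpace ℝ (Fin 3)) (Q : ℝ → EuclideanSpace ℝ (Fin 3) → ℝ),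
      IsBackwardLeraySolutionOn univ 1 W Q →
      (∀ k : ℕ, ∃ K : ℝ, ∀ s y, (1 + ‖y‖) ^ (k + 1) * ‖iteratedFDeriv ℝ k (W s) y‖ ≤ K) →
      ∀ δ : ℝ, 0 < δ → ∃ s : ℝ, ∀ y, ‖W s y‖ < δ := by
  intro hcrux W Q hW hWprof δ hδ
  have hzero : ∀ s y, W s y = 0 :=
    eternalLiouville_of_switchOff (stub_eternalLiouvilleOfCrux hcrux) W Q hW hWprof
  exact ⟨0, fun y => by rw [hzero 0 y, norm_zero]; exact hδ⟩

/-- **For the disprover**: any NONTRIVIAL eternal profile-class solution of Leray's backward system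
(a pointwise-Type-I ancient profile flow, switching off or not) refutes the crux
(contrapositive of `eternalLiouville_of_switchOff ∘ stub_eternalLiouvilleOfCrux`). -/
theorem not_noSelfExcitedDynamo_of_eternal_nontrivial
    {W : ℝ → EuclideanSpace ℝ (Fin 3) → EuclideanSpace ℝ (Fin 3)} {Q : ℝ → EuclideanSpace ℝ (Fin 3) → ℝ}
    (hW : IsBackwardLeraySolutionOn univ 1 W Q)
    (hprof : ∀ k : ℕ, ∃ K : ℝ, ∀ s y, (1 + ‖y‖) ^ (k + 1) * ‖iteratedFDeriv ℝ k (W s) y‖ ≤ K)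
    (hne : ∃ s y, W s y ≠ 0) : ¬ Theses.HubbleDynamo.NoSelfExcitedDynamo := by
  intro hcrux
  obtain ⟨s, y, hsy⟩ := hne
  exact hsy (eternalLiouville_of_switchOff (stub_eternalLiouvilleOfCrux hcrux) W Q hW hprof s y)

end Summit.NavierStokesRegularity.NavierStokesRegularity.Theorems.NoSelfExcitedDynamo.Registered

end
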